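/-
Origin: expansion seat `planner-pub-hodgecm-pv03-g4-0`, handover #1 v2 2026-08-18T07:53:50Z (`HOME/pub-hodgecm-pv03-g4/lean/Pv03g4/InputsWitness.lean`, md5 a464ce34, 687 lines);
landed by the gen-7 packager in gate run 26 as `HodgeCM/Model/ToyG2/InputsWitness.lean` (verbatim).
-/
/-
pub-hodgecm cell — DAG-NODE PROVER #03 gen 4 (session planner-pub-hodgecm-pv03-g4-0, unit pub-hodgecm-pv03-g4; node N33 =
PerL v5 Prop 4.3, seam S1).  WIP module `Pv03g4.InputsWitness`; proposed final place
`HodgeCM/Model/ToyG2/InputsWitness.lean` (module `HodgeCM.Model.ToyG2.InputsWitness`).  Imports only LANDED (runs ≤ 24) and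
run-25-staged tree modules: `HodgeCM.Model.ToyG2.{Axioms2, LevelExists}` (toy-g2, run 25), `HodgeCM.Model.Toy.CMFacts`,
`HodgeCM.Model.ThetaSeparation`, `HodgeCM.Model.PerLInhabited`, `HodgeCM.Literature.NormTheoremHolds`,
`HodgeCM.PerL34.AssemblyNoLandherr`.  Nothing is posited and nothing is cited: every statement below is kernel-proved from the
definitions; `#print axioms` of every declaration ⊆ {propext, Classical.choice, Quot.sound}.
-/
import Mathlib
import Summits.HodgeConjecture.HodgeCM.Model.ToyG2.Axioms2
import Summits.HodgeConjecture.HodgeCM.Model.ToyG2.LevelExists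
import Summits.HodgeConjecture.HodgeCM.Model.Toy.CMFacts
import Summits.HodgeConjecture.HodgeCM.Model.ThetaSeparation
import Summits.HodgeConjecture.HodgeCM.Model.PerLInhabited
import Summits.HodgeConjecture.HodgeCM.Literature.NormTheoremHolds
import Summits.HodgeConjecture.HodgeCM.PerL34.AssemblyNoLandherr

/-!
# A consistency witness for the typed inputs of the theta model: `ModelAxioms ∧ Inputs ∧ ¬HR(2,0) ∧ ¬PerL`

pub-hodgecm cell, DAG node **N33** (= PerL v5 Prop 4.3, typed in this package as `ThetaModel.Open_thetaWedge`), seam S1.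
KERNEL throughout — no citation is invoked and no statement is posited.

## The result

`inputs_consistent`: there exist a universe `U♯ : Universe` and a theta model `T♯ : U♯.ThetaModel` such that
* `U♯.ModelAxioms` (all 28 model facts),
* `T♯.Inputs` — ALL TEN typed inputs of the theta model (`Fact_embCover`, `Fact_innerEmb`, `Design_kappaConj`,
  `Design_frameSignConj`, `Open_thetaSub` = N12, `Open_thetaWedge` = **N33**, `Open_thetaGen12` = N19w, `Open_thetaReal34` = N19g,
  `Open_chars` = N31, `Open_occ` = N29),
* good seesaw contexts EXIST for `T♯` (`thetaSharp_exists_goodCtx`), so the `GoodCtx`-guarded inputs — in particular N33 — hold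
  NON-VACUOUSLY,
* and nevertheless `¬ U♯.Fact_hodgeRiemann20` and `¬ U♯.PerL` (also `¬ U♯.PerL44`).

Read against the node assembly `PerL34.perL_of_nodes''` (`ModelAxioms → h07 → h09a → h09b → h12a → h12b → h19w → h19g → h29 →
h31 → h33 → PerL`): every hypothesis EXCEPT `h07 : N07_hodgeRiemann20 U` holds at `(U♯, T♯)` (`nodes_hold`), `h07` fails there
(`h07_fails`), and the theorem with `h07` deleted is FALSE (`h07_loadBearing`).  So
1. the typed open nodes N09a/b, N12a/b, N19w/g, N29, N31, N33 are MUTUALLY CONSISTENT and consistent with the 28 model axioms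
   (the node assembly is not vacuously true through a hidden contradiction among its typed inputs);
2. `h07 = Fact_hodgeRiemann20` is LOAD-BEARING in `perL_of_nodes''` (and in every assembly factoring through
   `ThetaModel.realisationExistsPerL_of''`): it cannot be weakened away, the other inputs do not imply PerL;
3. node N33's typed content — in every good context there are a neat level `Γ` and theta one-forms `ω₀ ∈ Θ(V,c,0,Γ)`,
   `ω₁ ∈ Θ(V,c,1,Γ)` with `ω₀ ∪ ω₁ ≠ 0` — is realised here by GENUINE pulled-back CM `(1,0)`-classes with a genuinely computed
   non-zero cup product (`cup_cls_ne_zero`), in a model where good contexts exist.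

What it does NOT show.  Nothing about PerL itself: `U♯` violates Hodge–Riemann in degree `(2,0)`, so it is no counterexample
to PerL, only to "the typed inputs alone imply PerL".  And the ANALYTIC half of Prop 4.3 / Thm 4.4 (theta LIFTS, the spaces
`S₁₂`, `S₃₄`, occurrence, allowed characters) enters the typed nodes only through `emb`, `ϑ`, `S₁₂`, `𝒯_Φ`, which `T♯` takes to
be ZERO (§6): the witness thereby also records that the typed forms of N09a/b, N19w/g, N29, N31 are satisfied by the null
analytic side (cf. the seam-vacuity verdicts `PerL34.StepsVacuity`, pv03-g2, and `EndState.*`, pv01-g4) — their print content is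
not what the types capture; only N12/N33 and the two design constraints are exercised with non-trivial geometry here.

## The construction

* §1–§2.  For a presented CM field `L` (`F_L = FK L`, `n_L` = the number of CM sets `Θ ⊂ Hom(F_L, ℂ)`), the **block object**
  `P(L)`: the generation-1 toy object of shape `s ⊕ s` (`s` with `n_L` slots) whose atom at either copy of slot `Θ` is
  `(F_L, Θ)`; every CM set of `F_L` occurs exactly twice.  Period table `plSharp L ι₁ := (P(L), ℓ := 0)` and
  `U♯ := toyModel2With exteriorHodgeData TraceSys.zero plSharp` — toy-g2's generation-2 universe (admissible block maps, period
  blocks as the PMS objects) with ZERO traces; `U♯.ModelAxioms` is toy-g2's `toyModel2_zero_modelAxioms`, and `U♯` is its own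
  period-free shadow (`uSharp_periodFree : U♯.periodFree = U♯`, by `rfl`).
* §3–§5.  For `j : K →+* L`, a CM type `Ψ` of `K` with atom `(F_K, Φ)` and `σ ∈ Ψ`: the transported embedding
  `j_T : F_K →+* F_L`, the **induced CM set** `Θ = indSet j Ψ := {τ' | τ' ∘ j_T ∈ Φ}` of `F_L`, and for each of the two slots `i`
  of `P(L)` carrying `Θ` the block map `F_i : P(L) → A_Ψ`, `x ↦ j_T(x)` in slot `i` — a Hodge map because `1 ⊗ j_T` carries the
  trace idempotent `e_τ` into the span of the `e_τ'`, `τ' | τ` (`extC_eps_mem_span`), hence `F¹` into `F¹` (`linAt_isHodge`).  The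
  classes `cls_i := F_i^*(gen_σ)` lie in `U_iso(Γ; K, Ψ, σ)` (`cls_mem_uiso`), and **`cup_cls_ne_zero`**: for two types `Ψ₀, Ψ₁ ∋ σ`
  the cup product `cls_0(Ψ₀) ∪ cls_1(Ψ₁) ≠ 0` in `H²(P(L)) ⊗ ℂ` — `θ` intertwines base change and wedge (`Toy.BC.theta_wedge`,
  `theta_naturality`), each class is `(1 ⊗ j_T)(e_σ) ≠ 0` placed in its own slot (`theta_cls`), and a `2 × 2` coordinate minor of
  `v₀ ∧ v₁` is non-zero (`ιMulti_two_ne_zero`, via `exteriorPower.pairingDual`).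
* §6.  `T♯`: `Theta V c i Γ := U_iso(Γ; c.K, c.Ψ i, c.σ)` (N12 with equality), `cover := id` (the surface object does not depend
  on the level), `κ(τ) := τ ∘ j`, `frameSign :=` the indicator of the standard CM type of `L`; analytic side NULL: all
  `L²`-spaces `ℂ`, `emb := 0`, the null isolation core (`𝒯_Φ := 0`) and the null torus (`ϑ := 0`, `E := 0`, `S₁₂ := ⊥`, `P_w := 0`,
  `w` never occurs) on both sides.
* §7.  The ten inputs (`thetaSharp_inputs`; N33 = `thetaSharp_thetaWedge` at the level-3 principal congruence level
  `Level.three`, toy-g2 `LevelExists`); good contexts from the LANDED `ThetaModel.exists_goodCtx` (face datum of `ℚ(ζ₇)`,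
  Landherr's lemma KERNEL-proved as `lemma33bLandherr_holds`); `¬HR(2,0)` from the LANDED separation theorem
  `Universe.periodFree_not_hodgeRiemann_of_thetaWedge`, whose theta-model hypotheses are now DISCHARGED by `T♯`; `¬PerL` from
  `Universe.not_perL_periodFree`.
* §8.  The reading against `PerL34.perL_of_nodes''`.
* §9.  Conversely, WITH `h07`: over any model of the 28 facts satisfying `Fact_hodgeRiemann20`, the ten typed inputs force
  `emb_Γ(ω₀ ∪ ω₁) ≠ 0` for some theta one-forms in a good context (`emb_wedge_ne_zero_of_inputs`) — so no theta model with
  `emb = 0` has the inputs there (`not_inputs_of_emb_eq_zero`): the analytic side is engaged exactly through `h07` + N09b.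

Dependencies (all in the tree): toy-g2 `HodgeCM.Model.ToyG2.{Objects2, Universe2, Axioms2, LevelExists}` (run 25) and the
generation-1 `HodgeCM.Model.Toy.*`; `HodgeCM.Model.{ThetaSeparation, NonVacuity, PerLInhabited, PeriodFree, Inhabited}`;
`HodgeCM.Literature.NormTheoremHolds`; `HodgeCM.PerL34.AssemblyNoLandherr`.
-/

set_option autoImplicit false

noncomputable section

namespace HodgeCM.ToyG2.InputsWitness

open HodgeCM.Toy HodgeCM.Toy.CMPresentation HodgeCM.ToyG2 HodgeCM.ToyG2.Obj₂
open Literature.AlgebraicGeometry.Motives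
open scoped TensorProduct
open exteriorPower

/-! ### 1. Finite shapes -/

/-- the shape `unit ⊕ (unit ⊕ (… ⊕ empty))` with `n` slots -/
def finShape : ℕ → Shape
  | 0 => .empty
  | n + 1 => .sum .unit (finShape n)

/-- the slot of an index `k < n` -/
def slot : (n : ℕ) → Fin n → (finShape n).toType
  | 0, k => k.elim0
  | n + 1, k => Fin.cases (Sum.inl ()) (fun k' => Sum.inr (slot n k')) k

/-- the index of a slot -/
def unslot : (n : ℕ) → (finShape n).toType → Fin n
  | 0, x => (x : Empty).elim
  | _ + 1, Sum.inl _ => 0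
  | n + 1, Sum.inr x => (unslot n x).succ

/-- (Ported verbatim from the HodgeCMPerL package; no docstring in the source.) -/
@[simp] lemma unslot_slot : ∀ (n : ℕ) (k : Fin n), unslot n (slot n k) = k
  | 0, k => k.elim0
  | n + 1, k => by
      refine Fin.cases ?_ (fun k' => ?_) k
      · simp [slot, unslot]
      · simp [slot, unslot, unslot_slot n k']

/-! ### 2. The CM sets of a presented CM field and the block object `P(L)` -/

variable (L : CMField)

/-- the CM "types" of the presented field `FK L ⊆ ℂ`: sets of complex embeddings containing exactly one of each
conjugate pair -/
def CMSet : Type :=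
  {Θ : Set (FK L →+* ℂ) // ∀ τ, τ ∈ Θ ↔ NumberField.ComplexEmbedding.conjugate τ ∉ Θ}

/-- (Ported verbatim from the HodgeCMPerL package; no docstring in the source.) -/
instance : Finite (CMSet L) := by
  unfold CMSet; infer_instance

/-- their number -/
def nCM : ℕ := Nat.card (CMSet L)

/-- an enumeration -/
def enumCM : CMSet L ≃ Fin (nCM L) := Finite.equivFin (CMSet L)

/-- the atom `(FK L, Θ)` -/
@[reducible] def mkAtom (Θ : CMSet L) : Atom := { F := FK L, Φ := Θ.1, cm := Θ.2 }

/-- index type of the block object: two copies of the slots -/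
abbrev BIdx : Type := (finShape (nCM L)).toType ⊕ (finShape (nCM L)).toType

/-- the CM set sitting at an index -/
def setAt (i : BIdx L) : CMSet L := (enumCM L).symm (unslot (nCM L) (Sum.elim id id i))

/-- **the block object `P(L)`**: two copies of the family of all atoms `(FK L, Θ)`, `Θ` a CM set of `FK L` -/
@[reducible] def blockObj : Obj := ⟨.sum (finShape (nCM L)) (finShape (nCM L)), fun i => mkAtom L (setAt L i), 0⟩

/-- the slot of a CM set in the first copy … -/
def idx₀ (Θ : CMSet L) : BIdx L := Sum.inl (slot (nCM L) (enumCM L Θ))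

/-- … and in the second copy -/
def idx₁ (Θ : CMSet L) : BIdx L := Sum.inr (slot (nCM L) (enumCM L Θ))

/-- (Ported verbatim from the HodgeCMPerL package; no docstring in the source.) -/
@[simp] lemma setAt_idx₀ (Θ : CMSet L) : setAt L (idx₀ L Θ) = Θ := by simp [setAt, idx₀]

/-- (Ported verbatim from the HodgeCMPerL package; no docstring in the source.) -/
@[simp] lemma setAt_idx₁ (Θ : CMSet L) : setAt L (idx₁ L Θ) = Θ := by simp [setAt, idx₁]

/-- (Ported verbatim from the HodgeCMPerL package; no docstring in the source.) -/
lemma idx₀_ne_idx₁ (Θ Θ' : CMSet L) : idx₀ L Θ ≠ idx₁ L Θ' := Sum.inl_ne_inr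

/-- the block assignment: `P(L, ι₁) := (blockObj L, trace 0)` for every `ι₁` -/
def plSharp : PBlocks := fun L _ => ⟨blockObj L, 0⟩

/-- **the witness universe** `U♯`: toy-g2's generation-2 universe with the exterior Hodge data, the zero trace system
and the block assignment `plSharp` -/
abbrev USharp : Universe := toyModel2With exteriorHodgeData TraceSys.zero plSharp

/-- all 28 model axioms hold in `U♯` (toy-g2's `toyModel2_zero_modelAxioms`, valid for every block assignment) -/
theorem uSharp_modelAxioms : USharp.ModelAxioms := toyModel2_zero_modelAxioms plSharp

/-- `U♯` is its own period-free shadow (its trace system is zero) -/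
theorem uSharp_periodFree : USharp.periodFree = USharp := rfl

/- definitional sanity checks: `U♯` has the CM objects / isotypic lines of the generation-1 toy universe, its PMS object at
every level is the period block on `P(L)`, and every atom field of `P(L)` is `F_L` on the nose -/
example (K : CMField) (Ψ : CMType K) (σ : K →+* ℂ) :
    USharp.alphaLine K Ψ σ = (toyModelWith exteriorHodgeData).alphaLine K Ψ σ := rfl

example (L : CMField) (ι₁ : L →+* ℂ) (V : HermSpace3 L ι₁) (Γ : Level V) :
    USharp.pms L ι₁ V Γ = pbObj ⟨blockObj L, 0⟩ := rfl

example (L : CMField) (i : BIdx L) : ((blockObj L).atom i).F = FK L := rfl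


/-! ### 3. Base change of a field embedding on the trace-form idempotents -/

section Ext

variable {F F' : Type*} [Field F] [NumberField F] [Field F'] [NumberField F'] (m : F →+* F')

/-- `ℂ ⊗ m` as a `ℂ`-algebra homomorphism `ℂ ⊗ F → ℂ ⊗ F'` -/
def extC : ℂ ⊗[ℚ] F →ₐ[ℂ] ℂ ⊗[ℚ] F' := Algebra.TensorProduct.map (AlgHom.id ℂ ℂ) m.toRatAlgHom

/-- (Ported verbatim from the HodgeCMPerL package; no docstring in the source.) -/
@[simp] lemma extC_tmul (z : ℂ) (x : F) : extC m (z ⊗ₜ[ℚ] x) = z ⊗ₜ[ℚ] m x := by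
  simp [extC]

/-- (Ported verbatim from the HodgeCMPerL package; no docstring in the source.) -/
lemma extC_eq_baseChange (x : ℂ ⊗[ℚ] F) :
    extC m x = (m.toRatAlgHom.toLinearMap).baseChange ℂ x := by
  induction x using TensorProduct.induction_on with
  | zero => simp
  | tmul z y => simp [extC]
  | add x y hx hy => simp [map_add, hx, hy]

/-- (Ported verbatim from the HodgeCMPerL package; no docstring in the source.) -/
lemma extC_injective : Function.Injective (extC m) := by
  have h : Function.Injective ((m.toRatAlgHom.toLinearMap).baseChange ℂ) := by
    have := Module.Flat.lTensor_preserves_injective_linearMap (M := ℂ) (m.toRatAlgHom.toLinearMap)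
      (fun x y hxy => m.injective hxy)
    rwa [← LinearMap.baseChange_eq_ltensor] at this
  intro x y hxy
  apply h
  rw [← extC_eq_baseChange, ← extC_eq_baseChange]
  exact hxy

/-- `(ℂ ⊗ m)(eps τ)` is an eigenvector of `1 ⊗ m(k)` with eigenvalue `τ k` -/
lemma extC_eps_eigen (τ : F →+* ℂ) (k : F) :
    (1 ⊗ₜ[ℚ] m k) * extC m (eps F τ) = τ k • extC m (eps F τ) := by
  have h := congrArg (extC m) (tmul_mul_eps τ k)
  rwa [map_mul, map_smul, extC_tmul] at h

/-- **eigen-decomposition along a field extension**: `(ℂ ⊗ m)(eps_F τ)` lies in the span of the `eps_{F'} τ'`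
over the embeddings `τ'` of `F'` extending `τ` along `m` -/
lemma extC_eps_mem_span (τ : F →+* ℂ) :
    extC m (eps F τ) ∈ Submodule.span ℂ (eps F' '' {τ' : F' →+* ℂ | τ'.comp m = τ}) := by
  classical
  set x := extC m (eps F τ) with hxdef
  have hx : x = ∑ τ' : F' →+* ℂ, x * eps F' τ' := by rw [← Finset.mul_sum, sum_eps, mul_one]
  rw [hx]
  refine Submodule.sum_mem _ fun τ' _ => ?_
  by_cases h : τ'.comp m = τ
  · have hmem : eps F' τ' ∈ eps F' '' {τ' : F' →+* ℂ | τ'.comp m = τ} := ⟨τ', h, rfl⟩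
    exact Submodule.span_mono (Set.singleton_subset_iff.mpr hmem) (mul_eps_mem_span τ' x)
  · obtain ⟨k, hk⟩ := exists_apply_ne_of_ne h
    have hc : τ k ≠ τ' (m k) := fun h' => hk (by rw [RingHom.comp_apply]; exact h'.symm)
    rw [hxdef, mul_eps_eq_zero_of_eigen (extC_eps_eigen m τ k) hc]
    exact Submodule.zero_mem _

end Ext

/-! ### 4. An elementary non-vanishing criterion for `v₀ ∧ v₁` -/

/-- if two functionals `c₀, c₁` see `v₀, v₁` triangularly then `v₀ ∧ v₁ ≠ 0` (the `2 × 2` determinant pairing) -/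
lemma ιMulti_two_ne_zero {M : Type*} [AddCommGroup M] [Module ℂ M] (v₀ v₁ : M) (c₀ c₁ : Module.Dual ℂ M)
    (h₀ : c₀ v₀ ≠ 0) (h₁ : c₁ v₁ ≠ 0) (h₁₀ : c₁ v₀ = 0) : ιMulti ℂ 2 ![v₀, v₁] ≠ 0 := by
  intro h
  have key := pairingDual_ιMulti_ιMulti (R := ℂ) (M := M) ![c₀, c₁] ![v₀, v₁]
  rw [h, map_zero, Matrix.det_fin_two] at key
  simp only [Matrix.of_apply, Matrix.cons_val_zero, Matrix.cons_val_one, h₁₀, zero_mul,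
    sub_zero] at key
  exact mul_ne_zero h₀ h₁ key.symm

/-! ### 5. The morphisms `S(Γ) = P(L) → A_{(K,Ψ)}` and their theta classes -/

section Mor

variable {K L : CMField}

/-- `j : K →+* L` transported to the presentations `FK K`, `FK L` -/
def jT (j : K →+* L) : FK K →+* FK L := (eK L : L →+* FK L).comp (j.comp ((eK K).symm : FK K →+* K))

/-- the CM set of `FK L` **induced** from `Ψ` along `j`: the embeddings whose restriction along `j` lies in `Ψ` -/
def indSet (j : K →+* L) (Ψ : CMType K) : CMSet L :=
  ⟨{τ' | τ'.comp (jT j) ∈ (atomOf K Ψ).Φ}, by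
    intro τ'
    have h := Ψ.2 ((τ'.comp (jT j)).comp (eK K : K →+* FK K))
    have hc : NumberField.ComplexEmbedding.conjugate ((τ'.comp (jT j)).comp (eK K : K →+* FK K))
        = ((NumberField.ComplexEmbedding.conjugate τ').comp (jT j)).comp (eK K : K →+* FK K) := by
      ext x
      simp [NumberField.ComplexEmbedding.conjugate_coe_eq]
    rw [hc] at h
    exact h⟩

variable (L) in
/-- the family of lattice summands of `P(L)` (every member is `FK L`) -/
abbrev fam : BIdx L → Type := fun i => (((blockObj L).atom i).F : Type)

/-- the lattice map `L(A_{(K,Ψ)}) = FK K → L(P(L))`, `x ↦ (0, …, j x, …, 0)` (entry in slot `i`) -/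
def linAt (j : K →+* L) (Ψ : CMType K) (i : BIdx L) : (cmObj K Ψ).L →ₗ[ℚ] (blockObj L).L :=
  LinearMap.single ℚ (fam L) i ∘ₗ (jT j).toRatAlgHom.toLinearMap ∘ₗ
    LinearMap.proj (R := ℚ) (φ := fun _ : Unit => (FK K : Type)) ()

/-- (Ported verbatim from the HodgeCMPerL package; no docstring in the source.) -/
lemma linAt_baseChange_eT (j : K →+* L) (Ψ : CMType K) (i : BIdx L) (τ : FK K →+* ℂ) :
    (linAt j Ψ i).baseChange ℂ ((cmObj K Ψ).eT () τ)
      = (LinearMap.single ℚ (fam L) i).baseChange ℂ (extC (jT j) (eps (FK K) τ)) := by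
  change ((linAt j Ψ i).baseChange ℂ ∘ₗ
      (LinearMap.single ℚ (fun _ : Unit => (FK K : Type)) ()).baseChange ℂ) (eps (FK K) τ) = _
  have hc : linAt j Ψ i ∘ₗ LinearMap.single ℚ (fun _ : Unit => (FK K : Type)) ()
      = LinearMap.single ℚ (fam L) i ∘ₗ (jT j).toRatAlgHom.toLinearMap := by
    rw [linAt, LinearMap.comp_assoc, LinearMap.comp_assoc, LinearMap.proj_comp_single_same,
      LinearMap.comp_id]
  rw [← LinearMap.baseChange_comp, hc, LinearMap.baseChange_comp, LinearMap.comp_apply,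
    ← extC_eq_baseChange]

/-- the lattice map through slot `i` is a Hodge map as soon as slot `i` carries the induced CM set -/
lemma linAt_isHodge (j : K →+* L) (Ψ : CMType K) {i : BIdx L} (hi : setAt L i = indSet j Ψ) :
    Obj.IsHodge (linAt j Ψ i) := by
  rw [Obj.isHodge_iff]
  rintro ⟨⟩ τ hτ
  rw [linAt_baseChange_eT]
  have hle : (Submodule.span ℂ (eps (FK L) '' {τ' : FK L →+* ℂ | τ'.comp (jT j) = τ})).map
      ((LinearMap.single ℚ (fam L) i).baseChange ℂ) ≤ (blockObj L).F1 := by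
    rw [Submodule.map_span_le]
    rintro _ ⟨τ', hτ', rfl⟩
    have hτ'' : τ'.comp (jT j) = τ := hτ'
    refine Submodule.subset_span ⟨i, τ', ?_, rfl⟩
    change τ' ∈ (setAt L i).1
    rw [hi]
    change τ'.comp (jT j) ∈ (atomOf K Ψ).Φ
    rw [hτ'']
    exact hτ
  exact hle (Submodule.mem_map_of_mem (extC_eps_mem_span (jT j) τ))

/-- the morphism `P(L) → A_{(K,Ψ)}` of the gen-1 object layer through slot `i` -/
def homAt (j : K →+* L) (Ψ : CMType K) (i : BIdx L) (hi : setAt L i = indSet j Ψ) :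
    Obj.Hom (blockObj L) (cmObj K Ψ) :=
  ⟨linAt j Ψ i, linAt_isHodge j Ψ hi⟩

variable {ι₁ : L →+* ℂ} {V : HermSpace3 L ι₁}

/-- … as a morphism `S(Γ) = P(L) → A_{(K,Ψ)}` of `U♯` (admissible: the target is block-free) -/
def morAt (Γ : Level V) (j : K →+* L) (Ψ : CMType K) (i : BIdx L) (hi : setAt L i = indSet j Ψ) :
    USharp.Mor (USharp.pms L ι₁ V Γ) (USharp.cmAV K Ψ) :=
  Hom₂.ofHom (homAt j Ψ i hi) (isBlockFree_cmObj₂ K Ψ)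

/-- **the theta class through slot `i`**: the pull-back `F_i^*(gen_σ)` of the generator of the `σ`-eigenline of
`H¹(A_{(K,Ψ)}, ℂ)` -/
def cls (Γ : Level V) (j : K →+* L) (Ψ : CMType K) (σ : K →+* ℂ) (i : BIdx L)
    (hi : setAt L i = indSet j Ψ) : USharp.CohC (USharp.pms L ι₁ V Γ) 1 :=
  USharp.pullC (morAt Γ j Ψ i hi) 1 (gen K Ψ σ)

/-- (Ported verbatim from the HodgeCMPerL package; no docstring in the source.) -/
lemma gen_mem_alphaLine {Ψ : CMType K} {σ : K →+* ℂ} (hσ : σ ∈ Ψ.1) :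
    gen K Ψ σ ∈ USharp.alphaLine K Ψ σ := by
  change gen K Ψ σ ∈ (toyModelWith exteriorHodgeData).alphaLine K Ψ σ
  rw [alphaLine_eq]
  exact ⟨gen_mem_F1C K Ψ hσ, gen_mem_eigenLine exteriorHodgeData K Ψ σ⟩

/-- for holomorphic `σ ∈ Ψ` the class lies in `U_iso(Γ; K, Ψ, σ)` -/
lemma cls_mem_uiso (Γ : Level V) (j : K →+* L) {Ψ : CMType K} {σ : K →+* ℂ} (hσ : σ ∈ Ψ.1)
    (i : BIdx L) (hi : setAt L i = indSet j Ψ) :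
    cls Γ j Ψ σ i hi ∈ USharp.Uiso Γ K Ψ σ :=
  Submodule.subset_span ⟨morAt Γ j Ψ i hi, gen K Ψ σ, gen_mem_alphaLine hσ, rfl⟩

/-- the image vector `v_i = (F_i)_ℂ(e_σ) ∈ ℂ ⊗ L(P(L))` -/
def vec (j : K →+* L) (σ : K →+* ℂ) (i : BIdx L) : (blockObj L).LC :=
  (LinearMap.single ℚ (fam L) i).baseChange ℂ (extC (jT j) (eps (FK K) (embOf K σ)))

/-- under the base-change isomorphism `Θ₁`, the theta class through slot `i` is the vector `v_i` -/
lemma theta_cls (Γ : Level V) (j : K →+* L) (Ψ : CMType K) (σ : K →+* ℂ) (i : BIdx L)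
    (hi : setAt L i = indSet j Ψ) :
    BC.theta ℚ ℂ (blockObj L).L 1 (cls Γ j Ψ σ i hi) = (oneEquiv ℂ (blockObj L).LC).symm (vec j σ i) := by
  change BC.theta ℚ ℂ (blockObj L).L 1 ((map 1 (linAt j Ψ i)).baseChange ℂ
    ((T K Ψ).symm (eps (FK K) (embOf K σ)))) = _
  rw [T_symm_eps, BC.theta_naturality, BC.theta_one_baseChange_oneEquiv_symm, map_one_eq]
  simp only [LinearMap.coe_comp, LinearEquiv.coe_coe, Function.comp_apply, LinearEquiv.apply_symm_apply]
  rw [linAt_baseChange_eT]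
  rfl

/-- the coordinate functional `⟨i, τ'⟩` on `ℂ ⊗ L(P(L))` -/
def coordAt (i : BIdx L) (τ' : FK L →+* ℂ) : Module.Dual ℂ (blockObj L).LC :=
  (epsBasis (F := FK L)).coord τ' ∘ₗ (LinearMap.proj (R := ℚ) (φ := fam L) i).baseChange ℂ

/-- (Ported verbatim from the HodgeCMPerL package; no docstring in the source.) -/
lemma coordAt_single_same (i : BIdx L) (τ' : FK L →+* ℂ) (y : ℂ ⊗[ℚ] FK L) :
    coordAt i τ' ((LinearMap.single ℚ (fam L) i).baseChange ℂ y) = (epsBasis (F := FK L)).repr y τ' := by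
  change ((epsBasis (F := FK L)).coord τ' ∘ₗ ((LinearMap.proj (R := ℚ) (φ := fam L) i).baseChange ℂ ∘ₗ
    (LinearMap.single ℚ (fam L) i).baseChange ℂ)) y = _
  rw [← LinearMap.baseChange_comp, LinearMap.proj_comp_single_same, LinearMap.baseChange_id]
  simp [Module.Basis.coord_apply]


-- port_pkg: scope closed for this part
end Mor
end HodgeCM.ToyG2.InputsWitness
end
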